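import Summits.QuantumFields.BalabanUV.T4Continuum.Support.NE7PcTDivergenceSup
import Summits.QuantumFields.BalabanUV.T4Continuum.Support.NE7SharpGreenOfLaplacian
import HarnessLib

/-!
# NE7FlatTangentSupCurlDiv — THE FLAT SUP LETTER FOR EVERY `Q`-TANGENT VECTOR FIELD ON THE TORUS FROM ITS CURL AND THE MEAN-FREE PART OF ITS DIVERGENCE:
# `QvOp x = 0 ⟹ ‖x‖_∞ ≤ K·sup‖Fs x‖ + K′·sup‖(1 − Π′)∂ᴴx‖` (η-units, cubic tori, every spacing `n ≥ 1`, volume-uniform) — by THE FLAT ENERGY-GAUGE SPLIT `x = x̃ + ∂μ`,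
# `μ = G_Q[(1 − Π′)∂ᴴx]` the sharp block-mean-constrained potential, `x̃ ∈ 𝒯_E(1)` (memo ROAD-G100 §4 steps (4)–(5), the fresh flat torus of the bootstrap)

Cell `pub-balaban`, rung (B)+1 sub-cell t4, lineage `b2b-balaban-t4-ne7b-p1`, generation 150 (OWNER of BINDER row NE7b; junction service for the NE crew, ruling R-OWNER-149-1 (2)).
A JUNCTION for row NE7 (node U5): memo `t4/b2b-balaban-t4-ne7-p1-g100/ROAD-G100.md` §4 (the curved sup letter of the energy slice `𝒯_E(W)`, plan v2: lift to the cover, local axial gauge,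
cut-off, transplant onto a FRESH FLAT cubic torus, flat re-projection, read at the centre).  Steps (4)–(5) there: «`Z′ = Z̃ + ∂μ`, `Z̃ ∈ 𝒯_E(1)`, `μ ∈ Ξ_Q(1)`, `μ = −G_Q[(1−P_𝒦)∂^*Z′]`
(sharp constrained scalar Green's function; IR2 ✓ `NE7SharpConstrainedGradientRow.sharp_sup_rows_cubic`) … READ AT `z₀`: `‖Ỹ(z₀)‖ ≤ ‖Z̃(z₀)‖ + … + ‖∂μ(z₀)‖ ≤ K_flat·sup‖F₁(Z̃)‖ + θ·S₀`».
THIS FILE packages that flat line as ONE η-unit theorem on lit-balaban's torus `Tor (fine n M)` (cubic `M = fun _ ⇒ N₀`): for EVERY vector field `x` with `QvOp x = 0` (Bałaban's straight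
block average [B5] (1.18)), `‖x‖_∞ ≤ K·sup‖Fs x‖ + K′·sup‖(1 − Π′)(∂ᴴx)‖`, with `K` the constant of the flat energy-slice letter `NE7PcTDivergenceSup.energySlice_sup_flat` (t4-ne7b-p1
gen 149 ∕ t4-ne7-p1 gen 99) and `K′` the gradient row of IR2.  The SPLIT: `(μ, c)` := a sharp solution for the source `s := ∂ᴴx − Π′(∂ᴴx)` (`exists_sharp_solution`: `Q′μ = 0`, `Δμ = s + Q′*c`),
`x̃ := x − ∂μ` (= `B5Action121.gaugeT … x μ`).  Then (i) `QvOp x̃ = QvOp x − ∂₁(Q′μ) = QvOp x` ([B5] (1.20), `B5Block118.QvOp_gaugeT_eq`; `Q′μ = 0`); (ii) `∂ᴴx̃ = ∂ᴴx − Δμ =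
Π′(∂ᴴx) − Q′*c = Q′*(Q′(∂ᴴx) − c)` is BLOCK-CONSTANT (the energy gauge); (iii) `Fs x̃ = Fs x` (`B5Action121.Fs_gaugeT`); so the flat letter bounds `x̃` by `K·sup‖Fs x‖`, and IR2 bounds
`∂μ` bond by bond by `C·sup‖s‖`.  No derivative of `x` beyond its curl and divergence; no logarithm; uniform in `n` and in the cubic torus.
WHAT ([folklore]; 0 def, 0 sorry; cubic tori `Fin (d+1) → ℕ`, `n ≥ 1`).
§1 `norm_PiS_mulVec_le` (`‖(Π′g)(y)‖ ≤ sup‖g‖`), `norm_sub_PiS_le` (`‖((1 − Π′)g)(y)‖ ≤ 2·sup‖g‖`), `QvOp_gaugeT_of_QsOp_eq_zero` (`Q′μ = 0 ⟹ QvOp(x − ∂μ) = QvOp x`),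
   `gradOpH_gaugeT_of_sharp` (`∂ᴴ(x − ∂μ) = Q′*(Q′(∂ᴴx) − c)` for a sharp solution `(μ, c)` of the source `(1 − Π′)∂ᴴx`).
§2 **`flat_energy_split`** (every torus `Fin (d+1)`: `∀ x, ∃ μ c′, Q′μ = 0 ∧ QvOp(x − ∂μ) = QvOp x ∧ ∂ᴴ(x − ∂μ) = Q′*c′ ∧ Fs(x − ∂μ) = Fs x ∧ Δμ = (1 − Π′)∂ᴴx + Q′*(Q′∂ᴴx − c′)`).
§3 **`tangent_sup_flat`** (`∃ K K′ > 0`: `QvOp x = 0`, `‖Fs x‖ ≤ B`, `‖(1 − Π′)∂ᴴx‖ ≤ D` ⟹ `‖x i‖ ≤ K·B + K′·D` at every bond `i`), **`tangent_sup_flat_of_div`** (`‖∂ᴴx‖ ≤ D₀ ⟹ ‖x i‖ ≤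
   K·B + 2K′·D₀`), and the split WITH ITS ROWS **`flat_energy_split_rows`** (`QvOp x = 0` ⟹ `x = x̃ + ∂μ` with `QvOp x̃ = 0`, `∂ᴴx̃` block-constant, `Fs x̃ = Fs x`, `‖x̃ i‖ ≤ K·B`,
   `‖(∂μ) i‖ ≤ K′·D`, `‖μ y‖ ≤ K′·D`, `Q′μ = 0`).
HONEST FRAMING (page 1): linear algebra over LANDED theorems BY NAME (`energySlice_sup_flat` — itself resting on GAN24's Combes–Thomas rows —, IR2, B5's (1.20) and gauge invariance of
`Fs`); constants existential; `U = 1`, flat, linear; NOT the curved letter (the bootstrap's cover ∕ axial gauge ∕ cut-off ∕ dictionary steps are the road's), NOT (S1), NOT NE7, nothing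
of row NE7b; spine 0∕9; finite T⁴ rung (B)+1 — NOT infinite volume, NOT mass gap, NOT BetaPertH, NOT Clay.  [Balaban1984PropagatorsI] (1.18), (1.20), (1.26) are TEXT LOCATIONS; nothing
printed is asserted.  Continuum YM on T⁴ ⇐ BetaPertH ∧ nine spine estimates (0/9 proved); BetaPertH ⇐ (D1) ∧ (D4) ∧ CAP+tail; G-an2-4 gates asym, D1 and NE2/3/4.
-/

set_option autoImplicit false

open scoped BigOperators Matrix ComplexConjugate

namespace Summit.QuantumFields.BalabanUV.T4Continuum.NE7FlatTangentSupCurlDiv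

open Literature.MathematicalPhysics.QuantumFieldTheory.Balaban1983to89
open B5Prop11Plancherel (Tor fine)
open B5Action121 (LapS sdiff Fs GradOp GradOp_mulVec gaugeT Fs_gaugeT)
open B5Block118 (QsOp QvOp QvOp_gaugeT_eq)
open B5Blocks16 (blockOf)
open Summit.QuantumFields.BalabanUV.T4Continuum.ScalarBlockPoincare (PiS)
open Summit.QuantumFields.BalabanUV.Beta.GAN24.SoftMinimiserOneStepSup (blkInj blkInj_mulVec)
open Summit.QuantumFields.BalabanUV.Beta.GAN24.HardMinimiserOneStepSup (norm_QsOp_mulVec_le)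
open NE7SharpConstrainedGradientRow (exists_sharp_solution sharp_sup_rows_cubic)
open NE7SharpGreenOfLaplacian (PiS_mulVec_eq_blkInj gradOpH_gradOp_mulVec)
open NE7PcTDivergenceSup (energySlice_sup_flat)

noncomputable section

variable {d : ℕ}

/-! ## §1 Pieces: the block projection's sup row, (1.20) for a block-mean-zero gauge function, the divergence after the sharp gauge -/

section Pieces

variable (n : ℕ) [NeZero n] (M : Fin (d + 1) → ℕ) [∀ μ, NeZero (M μ)]

/-- `‖(Π′g)(y)‖ ≤ b` when `‖g‖_∞ ≤ b` (`Π′g` is the block mean of `g`, injected). [folklore] -/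
theorem norm_PiS_mulVec_le (g : Tor (fine n M) → ℂ) {b : ℝ} (hg : ∀ y, ‖g y‖ ≤ b) (y : Tor (fine n M)) : ‖(PiS n M *ᵥ g) y‖ ≤ b := by
  rw [PiS_mulVec_eq_blkInj, blkInj_mulVec]
  exact norm_QsOp_mulVec_le n M g hg _

/-- `‖((1 − Π′)g)(y)‖ ≤ 2b` when `‖g‖_∞ ≤ b`. [folklore] -/
theorem norm_sub_PiS_le (g : Tor (fine n M) → ℂ) {b : ℝ} (hg : ∀ y, ‖g y‖ ≤ b) (y : Tor (fine n M)) :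
    ‖(g - PiS n M *ᵥ g) y‖ ≤ 2 * b := by
  rw [Pi.sub_apply]
  calc ‖g y - (PiS n M *ᵥ g) y‖ ≤ ‖g y‖ + ‖(PiS n M *ᵥ g) y‖ := norm_sub_le _ _
    _ ≤ b + b := add_le_add (hg y) (norm_PiS_mulVec_le n M g hg y)
    _ = 2 * b := by ring

/-- **(1.20) FOR A BLOCK-MEAN-ZERO GAUGE FUNCTION**: `Q′μ = 0 ⟹ QvOp(x − ∂μ) = QvOp x` — a gauge direction generated inside `ker Q′` is `Q`-tangent. [folklore] -/
theorem QvOp_gaugeT_of_QsOp_eq_zero (x : Tor (fine n M) × Fin (d + 1) → ℂ) {μ : Tor (fine n M) → ℂ} (hμ : QsOp n M *ᵥ μ = 0) :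
    QvOp n M *ᵥ gaugeT (fine n M) (n : ℂ) x μ = QvOp n M *ᵥ x := by
  rw [QvOp_gaugeT_eq, hμ, Matrix.mulVec_zero, sub_zero]

/-- **THE DIVERGENCE AFTER THE SHARP GAUGE IS BLOCK-CONSTANT**: if `(μ, c)` is a sharp solution for the source `∂ᴴx − Π′(∂ᴴx)` (`Δμ = (∂ᴴx − Π′∂ᴴx) + Q′*c`) then
`∂ᴴ(x − ∂μ) = Q′*(Q′(∂ᴴx) − c)`. [folklore] -/
theorem gradOpH_gaugeT_of_sharp (x : Tor (fine n M) × Fin (d + 1) → ℂ) {μ : Tor (fine n M) → ℂ} {c : Tor M → ℂ}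
    (hL : LapS (fine n M) (n : ℂ) *ᵥ μ
      = ((GradOp (fine n M) (n : ℂ))ᴴ *ᵥ x - PiS n M *ᵥ ((GradOp (fine n M) (n : ℂ))ᴴ *ᵥ x)) + blkInj n M *ᵥ c) :
    (GradOp (fine n M) (n : ℂ))ᴴ *ᵥ gaugeT (fine n M) (n : ℂ) x μ
      = blkInj n M *ᵥ (QsOp n M *ᵥ ((GradOp (fine n M) (n : ℂ))ᴴ *ᵥ x) - c) := by
  rw [gaugeT, Matrix.mulVec_sub ((GradOp (fine n M) (n : ℂ))ᴴ) x, gradOpH_gradOp_mulVec, hL, PiS_mulVec_eq_blkInj,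
    Matrix.mulVec_sub (blkInj n M)]
  abel

/-- `(x − ∂μ)` at a bond: `x i − (∂_ν μ)(y)` for `i = (y, ν)`. [folklore] -/
theorem gaugeT_apply (x : Tor (fine n M) × Fin (d + 1) → ℂ) (μ : Tor (fine n M) → ℂ) (y : Tor (fine n M)) (ν : Fin (d + 1)) :
    gaugeT (fine n M) (n : ℂ) x μ (y, ν) = x (y, ν) - (sdiff (fine n M) (n : ℂ) ν *ᵥ μ) y := by
  rw [gaugeT, Pi.sub_apply, GradOp_mulVec]

end Pieces

/-! ## §2 The flat energy-gauge split on the torus (every torus) -/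

/-- **THE FLAT ENERGY-GAUGE SPLIT ON THE TORUS**: every vector field `x` is `x̃ + ∂μ` with `Q′μ = 0` (so `QvOp x̃ = QvOp x`), `∂ᴴx̃` BLOCK-CONSTANT, `Fs x̃ = Fs x`, and `μ` THE sharp
block-mean-constrained potential of the source `(1 − Π′)∂ᴴx` (so IR2 prices `μ`, `∂μ`).  Every torus `Fin (d+1) → ℕ`, every `n`. [folklore] -/
theorem flat_energy_split (n : ℕ) [NeZero n] (M : Fin (d + 1) → ℕ) [∀ μ, NeZero (M μ)] (x : Tor (fine n M) × Fin (d + 1) → ℂ) :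
    ∃ (μ : Tor (fine n M) → ℂ) (c : Tor M → ℂ),
      QsOp n M *ᵥ μ = 0 ∧
      LapS (fine n M) (n : ℂ) *ᵥ μ
        = ((GradOp (fine n M) (n : ℂ))ᴴ *ᵥ x - PiS n M *ᵥ ((GradOp (fine n M) (n : ℂ))ᴴ *ᵥ x)) + blkInj n M *ᵥ c ∧
      QvOp n M *ᵥ gaugeT (fine n M) (n : ℂ) x μ = QvOp n M *ᵥ x ∧
      (GradOp (fine n M) (n : ℂ))ᴴ *ᵥ gaugeT (fine n M) (n : ℂ) x μ
        = blkInj n M *ᵥ (QsOp n M *ᵥ ((GradOp (fine n M) (n : ℂ))ᴴ *ᵥ x) - c) ∧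
      ∀ (α β : Fin (d + 1)) (t : Tor (fine n M)), Fs (fine n M) (n : ℂ) (gaugeT (fine n M) (n : ℂ) x μ) α β t = Fs (fine n M) (n : ℂ) x α β t := by
  obtain ⟨μ, c, hQ, hL⟩ := exists_sharp_solution n M ((GradOp (fine n M) (n : ℂ))ᴴ *ᵥ x - PiS n M *ᵥ ((GradOp (fine n M) (n : ℂ))ᴴ *ᵥ x))
  exact ⟨μ, c, hQ, hL, QvOp_gaugeT_of_QsOp_eq_zero n M x hQ, gradOpH_gaugeT_of_sharp n M x hL, fun α β t => Fs_gaugeT _ _ x μ α β t⟩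

/-! ## §3 The letter on cubic tori: `‖x‖_∞ ≤ K·sup‖Fs x‖ + K′·sup‖(1 − Π′)∂ᴴx‖` for `Q`-tangent `x` -/

/-- **THE FLAT ENERGY-GAUGE SPLIT WITH ITS ROWS** (cubic tori, `n ≥ 1`): `∃ K K′ > 0 (d)` such that for every `Q`-tangent `x` (`QvOp x = 0`) with `‖Fs x‖ ≤ B` and `‖(1 − Π′)∂ᴴx‖ ≤ D` there are
`μ` (`Q′μ = 0`, `‖μ‖_∞ ≤ K′·D`, `‖∂_νμ‖_∞ ≤ K′·D` for all `ν`) and the slice part `x̃ := x − ∂μ` with `QvOp x̃ = 0`, `∂ᴴx̃ ∈ range Q′*` (block-constant divergence: `x̃ ∈ 𝒯_E(1)` read on the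
torus), `Fs x̃ = Fs x` and `‖x̃ i‖ ≤ K·B` at every bond. [folklore] -/
theorem flat_energy_split_rows (d : ℕ) :
    ∃ K K' : ℝ, 0 < K ∧ 0 < K' ∧ ∀ (n N₀ : ℕ) [NeZero n] [NeZero N₀], 1 ≤ n →
      ∀ (x : Tor (fine n (fun _ : Fin (d + 1) => N₀)) × Fin (d + 1) → ℂ), QvOp n (fun _ : Fin (d + 1) => N₀) *ᵥ x = 0 →
      ∀ B D : ℝ,
        (∀ (α β : Fin (d + 1)) (t : Tor (fine n (fun _ : Fin (d + 1) => N₀))), ‖Fs (fine n (fun _ : Fin (d + 1) => N₀)) (n : ℂ) x α β t‖ ≤ B) →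
        (∀ y, ‖((GradOp (fine n (fun _ : Fin (d + 1) => N₀)) (n : ℂ))ᴴ *ᵥ x
                - PiS n (fun _ : Fin (d + 1) => N₀) *ᵥ ((GradOp (fine n (fun _ : Fin (d + 1) => N₀)) (n : ℂ))ᴴ *ᵥ x)) y‖ ≤ D) →
        ∃ μ : Tor (fine n (fun _ : Fin (d + 1) => N₀)) → ℂ,
          QsOp n (fun _ : Fin (d + 1) => N₀) *ᵥ μ = 0 ∧
          (∀ y, ‖μ y‖ ≤ K' * D) ∧
          (∀ (ν : Fin (d + 1)) (y : Tor (fine n (fun _ : Fin (d + 1) => N₀))), ‖(sdiff (fine n (fun _ : Fin (d + 1) => N₀)) (n : ℂ) ν *ᵥ μ) y‖ ≤ K' * D) ∧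
          QvOp n (fun _ : Fin (d + 1) => N₀) *ᵥ gaugeT (fine n (fun _ : Fin (d + 1) => N₀)) (n : ℂ) x μ = 0 ∧
          (∃ c' : Tor (fun _ : Fin (d + 1) => N₀) → ℂ,
            (GradOp (fine n (fun _ : Fin (d + 1) => N₀)) (n : ℂ))ᴴ *ᵥ gaugeT (fine n (fun _ : Fin (d + 1) => N₀)) (n : ℂ) x μ
              = blkInj n (fun _ : Fin (d + 1) => N₀) *ᵥ c') ∧
          (∀ (α β : Fin (d + 1)) (t : Tor (fine n (fun _ : Fin (d + 1) => N₀))),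
            Fs (fine n (fun _ : Fin (d + 1) => N₀)) (n : ℂ) (gaugeT (fine n (fun _ : Fin (d + 1) => N₀)) (n : ℂ) x μ) α β t
              = Fs (fine n (fun _ : Fin (d + 1) => N₀)) (n : ℂ) x α β t) ∧
          ∀ i, ‖gaugeT (fine n (fun _ : Fin (d + 1) => N₀)) (n : ℂ) x μ i‖ ≤ K * B := by
  obtain ⟨K, hK, hflat⟩ := energySlice_sup_flat d
  obtain ⟨C, hC, hIR2⟩ := sharp_sup_rows_cubic d
  refine ⟨K, C, hK, hC, fun n N₀ _ _ hn x hx B D hB hD => ?_⟩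
  obtain ⟨μ, c, hQ, hL, hQv, hdiv, hFs⟩ := flat_energy_split n (fun _ : Fin (d + 1) => N₀) x
  obtain ⟨-, hμ, hdμ⟩ := hIR2 n N₀ hn _ μ c D hD hQ hL
  have hQv0 : QvOp n (fun _ : Fin (d + 1) => N₀) *ᵥ gaugeT (fine n (fun _ : Fin (d + 1) => N₀)) (n : ℂ) x μ = 0 := by rw [hQv, hx]
  have hB' : ∀ (α β : Fin (d + 1)) (t : Tor (fine n (fun _ : Fin (d + 1) => N₀))),
      ‖Fs (fine n (fun _ : Fin (d + 1) => N₀)) (n : ℂ) (gaugeT (fine n (fun _ : Fin (d + 1) => N₀)) (n : ℂ) x μ) α β t‖ ≤ B := fun α β t => by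
    rw [hFs]; exact hB α β t
  exact ⟨μ, hQ, hμ, hdμ, hQv0, ⟨_, hdiv⟩, hFs, hflat n N₀ hn _ hQv0 ⟨_, hdiv⟩ B hB'⟩

/-- **THE FLAT SUP LETTER FOR EVERY `Q`-TANGENT FIELD FROM CURL AND MEAN-FREE DIVERGENCE** (cubic tori, `n ≥ 1`, uniform): `∃ K K′ > 0 (d)`: `QvOp x = 0`, `‖Fs x‖ ≤ B`,
`‖(1 − Π′)∂ᴴx‖ ≤ D` ⟹ `‖x i‖ ≤ K·B + K′·D` at every bond `i`.  (`D = 0` ⟺ block-constant divergence = the energy slice: `NE7PcTDivergenceSup.energySlice_sup_flat`.) [folklore] -/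
theorem tangent_sup_flat (d : ℕ) :
    ∃ K K' : ℝ, 0 < K ∧ 0 < K' ∧ ∀ (n N₀ : ℕ) [NeZero n] [NeZero N₀], 1 ≤ n →
      ∀ (x : Tor (fine n (fun _ : Fin (d + 1) => N₀)) × Fin (d + 1) → ℂ), QvOp n (fun _ : Fin (d + 1) => N₀) *ᵥ x = 0 →
      ∀ B D : ℝ,
        (∀ (α β : Fin (d + 1)) (t : Tor (fine n (fun _ : Fin (d + 1) => N₀))), ‖Fs (fine n (fun _ : Fin (d + 1) => N₀)) (n : ℂ) x α β t‖ ≤ B) →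
        (∀ y, ‖((GradOp (fine n (fun _ : Fin (d + 1) => N₀)) (n : ℂ))ᴴ *ᵥ x
                - PiS n (fun _ : Fin (d + 1) => N₀) *ᵥ ((GradOp (fine n (fun _ : Fin (d + 1) => N₀)) (n : ℂ))ᴴ *ᵥ x)) y‖ ≤ D) →
        ∀ i, ‖x i‖ ≤ K * B + K' * D := by
  obtain ⟨K, K', hK, hK', h⟩ := flat_energy_split_rows d
  refine ⟨K, K', hK, hK', fun n N₀ _ _ hn x hx B D hB hD i => ?_⟩
  obtain ⟨μ, -, -, hdμ, -, -, -, hxt⟩ := h n N₀ hn x hx B D hB hD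
  obtain ⟨y, ν⟩ := i
  have e : x (y, ν) = gaugeT (fine n (fun _ : Fin (d + 1) => N₀)) (n : ℂ) x μ (y, ν) + (sdiff (fine n (fun _ : Fin (d + 1) => N₀)) (n : ℂ) ν *ᵥ μ) y := by
    rw [gaugeT_apply, sub_add_cancel]
  rw [e]
  exact (norm_add_le _ _).trans (add_le_add (hxt (y, ν)) (hdμ ν y))

/-- **THE SAME WITH THE FULL DIVERGENCE**: `QvOp x = 0`, `‖Fs x‖ ≤ B`, `‖∂ᴴx‖ ≤ D₀` ⟹ `‖x i‖ ≤ K·B + 2K′·D₀` (`‖(1 − Π′)g‖ ≤ 2‖g‖`). [folklore] -/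
theorem tangent_sup_flat_of_div (d : ℕ) :
    ∃ K K' : ℝ, 0 < K ∧ 0 < K' ∧ ∀ (n N₀ : ℕ) [NeZero n] [NeZero N₀], 1 ≤ n →
      ∀ (x : Tor (fine n (fun _ : Fin (d + 1) => N₀)) × Fin (d + 1) → ℂ), QvOp n (fun _ : Fin (d + 1) => N₀) *ᵥ x = 0 →
      ∀ B D₀ : ℝ,
        (∀ (α β : Fin (d + 1)) (t : Tor (fine n (fun _ : Fin (d + 1) => N₀))), ‖Fs (fine n (fun _ : Fin (d + 1) => N₀)) (n : ℂ) x α β t‖ ≤ B) →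
        (∀ y, ‖((GradOp (fine n (fun _ : Fin (d + 1) => N₀)) (n : ℂ))ᴴ *ᵥ x) y‖ ≤ D₀) →
        ∀ i, ‖x i‖ ≤ K * B + 2 * K' * D₀ := by
  obtain ⟨K, K', hK, hK', h⟩ := tangent_sup_flat d
  refine ⟨K, K', hK, hK', fun n N₀ _ _ hn x hx B D₀ hB hD₀ i => ?_⟩
  have hD : ∀ y, ‖((GradOp (fine n (fun _ : Fin (d + 1) => N₀)) (n : ℂ))ᴴ *ᵥ x
      - PiS n (fun _ : Fin (d + 1) => N₀) *ᵥ ((GradOp (fine n (fun _ : Fin (d + 1) => N₀)) (n : ℂ))ᴴ *ᵥ x)) y‖ ≤ 2 * D₀ :=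
    fun y => norm_sub_PiS_le n _ _ hD₀ y
  calc ‖x i‖ ≤ K * B + K' * (2 * D₀) := h n N₀ hn x hx B (2 * D₀) hB hD i
    _ = K * B + 2 * K' * D₀ := by ring

end

end Summit.QuantumFields.BalabanUV.T4Continuum.NE7FlatTangentSupCurlDiv
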